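import Summits.ABC.ABC.Theses.TwistAmplification
import Literature.NumberTheory.DiophantineGeometry.AbcShapeReductionCount

/-!
# Line `critical-kloosterman-powerful-moduli` — crux `TwistAmplification.MazurKaneLaw` (stmt-ABC-2757)

Skeleton of the line (crux-plan, planner-cruxplan-stmt-ABC-2757-critical-kloosterman-0, 2026-08-16) for the
triaged crux idea `critical-kloosterman-powerful-moduli` (crux-ideate r1, ideator 1; triage r1: 3 × pass, all
three "unverified — card body unreadable in the triage jails"; the card body is ALSO unreadable in this planner
jail (`run/gate/evidence/**` not mounted), so the lever is reconstructed from the card's public metadata —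
"spectral/Kloosterman lever for the wall family; first lemma `WallCubeSaving`, target `WallMazur`" — from the
three TRIAGE-r1-k.md analyses, and from the companion map line `Lines/fibre-toolkit-lp-wall-map.lean`).

THE CRUX. `MazurKaneLaw`: for every `1 < s < 2`, `ε > 0`: `#{abc triples, c ≤ N, rad(abc) ≤ c^s} ≤ C N^{s-1+ε}`.

THE LINE, in the tree's shape language (`AbcShapes`: `a = c₁ ∏ᵢ xᵢ^{i+1}`, coordinate `0` LINEAR, `1` the
SQUARE level, `≥ 2` cube-full; a class at dyadic scale `C₀` has data `(C₀; c₁,c₂,c₃; X,Y,Z)`,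
`AbcShapes.Admissible s ε`; `B = shapeCount`; `P = ∏ᵢ XᵢYᵢZᵢ ≤ (2C₀)^{s+3ε}`, `P₀ = X₀Y₀Z₀`, `P₁ = X₁Y₁Z₁`,
`R = C₀^{s-1+3ε}` = the law, `Θ³ = (c₁·shapeVal X)(c₂·shapeVal Y)(c₃·shapeVal Z)/(2C₀)³ ≤ 1` the deficiency).

1. OFF THE WALL (`OffWallLaw`, provable now): if `P ≤ 2R·P₀` (GoN certificate) or
   `P ≤ 2R·P₁ ∧ P³ ≤ 64R³·Θ³(2C₀)³` (conic certificate) the law `B ≤ K C₀^{s-1+3ε+η}` follows from the two fibre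
   tools of the tree — Kane/Bernert lattices in the linear variables (`shapeCount_succ_le` /
   `shapeCount_le_geometry_sets`: `B ≤ 2P/P₀ + 112V₂P/C₀`), resp. the SHARP CONIC (determinant method,
   `SquarefulDet.fiberBound`, `n = 1`, full modulus `|ABC| ≥ Θ³(2C₀)³/P₁²`: `B ≤ C₀^η(P/P₁ + P/(Θ·2C₀))`; both
   terms are `≤ 4R` exactly under the two conic inequalities — the second one is where LOPSIDED triples
   `a ≪ c^{1-e}`, `Θ = C₀^{-e/3}`, pay their deficiency).
2. THE STRUCTURE INEQUALITY (proved below, `prod_cube_le`): `P³ ≤ Θ³(2C₀)³·P₀²·P₁`, because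
   `∏ᵢ xᵢ^{i+1} ≥ x₀x₁²(∏_{i≥2}xᵢ)³`. Hence the complement of (1) — the BAD region, where Kane's "+1 per
   lattice" `2P/P₀` exceeds the law — has LINEAR DEPTH `P/(R P₀) ≤ 2C₀·P₀^{-1/3}(Θ³P₁)^{1/3}/R` (also
   `P² ≤ Θ³(2C₀)³·P₀`, `prod_sq_le_three`, which controls the lopsided non-conic data), and its extreme
   point at exponent `s = 2 - δ` is the WALL FAMILY `P₀ = P₁ = C₀^{1-δ}`, `P₂ = C₀^{δ}`
   (`a, b, c = u·x²·w³`, `u ≍ x ≍ N^{(1-δ)/3}`, `w ≍ N^{δ/3}`; ideator 1's "P1 = P2 = X^{l-1}, P3 = X^{2-l}",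
   ideator 2's enemy (2), TRIAGE r1-2/3's common enemy): `N` lattices `Λ = {(u₀,u₁) : a₃ ∣ a₁u₀ + a₂u₁}` of
   covolume `a₃ = c₃z₁²z₂³⋯ ≍ N^{(2+δ)/3}` probed in a box `U² = N^{2(1-δ)/3} < a₃` — sub-Minkowski, so Kane
   counts `N` and the truth/law is `N^{1-δ}`; the SAVING NEEDED is the full depth `C₀^{δ}` (TRIAGE r1-2: "full
   saving forced").
3. THE LEVER (`NearWallLaw`, OPEN, hardest): on the bad region up to linear depth `1/4`
   (`P ≤ 2R·C₀^{1/4}·P₀`) the occupied lattices are as many as expected: `B ≤ K C₀^{s-1+3ε+η}`. WHY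
   KLOOSTERMAN, WHY POWERFUL MODULI, WHY CRITICAL (the idea): the moduli `a₃ = c₃·z₁²z₂³z₃⁴⋯` of the
   linear-level lattices are SQUAREFULL up to the cofactor `c₃ ≤ (2C₀)^{ε/2}` — always, by construction of the
   shape normal form — so after Poisson summation in `u₁` the dual sums
   `Σ_{k ≤ a₃/U} Σ_{u₀ ~ U} Σ_{y₁ ~ X₁} e(k·u₀·a₁·\overline{c₂ y₁² y₂³⋯}/a₃)` carry complete Kloosterman/Salié
   sums to squarefull moduli, which EVALUATE by `p`-adic stationary phase into explicit algebraic exponentials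
   (Iwaniec–Kowalski §12.3), and the remaining incomplete sums have explicit phases to which `q`-van der Corput
   along `a₃ = (z₁z₂²)·(z₁z₂)` and the large sieve for square moduli apply; "critical" because on the wall
   `X₁ ≍ z₁ ≍ a₃^{1/2}·N^{-δ/2}` — the `y₁`-sums sit exactly at the completion / Pólya–Vinogradov threshold and
   the differencing modulus `z₁z₂²` EXCEEDS the length `X₁` by `W²`, so single-modulus methods are void and
   the average over the `≍ N^{1/3}` moduli `z'` and over `k·u₀` (length `a₃`) must carry the cancellation.
   NUMBERS (symmetric wall, `s = 2-δ`): after Poisson in `u₁` the error term is trivially `N^{(4-δ)/3}`, the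
   law is `N^{1-δ}`, so the `(k, u₀, y₁)`-sum of total length `N` must show cancellation `N^{(1+2δ)/3}`;
   square-root cancellation in these three variables gives exactly `δ ≤ 1/4`, which is where the depth
   `τ₀ = 1/4` of this skeleton comes from (it is also where the expected number `U³/a₃ = N^{(1-4δ)/3}` of
   occupied `y₁` per `(x', z', y₂)`-family drops below `1`: beyond depth `1/4` the lever meets a second-order
   "+1" problem). A fixed power saving `ρ` at the critical point proves `NearWallLaw` with `1/4` replaced by a
   `τ₁(ρ) > 0` (reshape = that one constant) and still yields the FIRST range below Kane's `s ≥ 2` (side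
   theorem below with `15/8` replaced by `2 - τ₁/2`).
4. THE DEEP RESIDUAL (`DeepResidualLaw`, open, FOREIGN — not attacked by this line, recorded so that the
   composition is honest about `∀ s ∈ (1,2)`): bad-region data of linear depth `> 1/4`. By (2) this region is
   EMPTY for `s ≥ 15/8` (`not_deep`, proved below: the symmetric-wall part already for `s ≥ 11/6`, the
   lopsided conic-deficient part for `s ≥ 15/8`), non-empty below (symmetric wall of depth `δ > 1/4`,
   cube-heavy and twisted-Fermat boxes below `5/3`, and at `s → 1⁺` "abc hits `≪ N^{δ}`"); candidate levers on
   file: `peyre-level-torsor-v22` / `heegner-cusp-subholzer` (reach `5/3`), `aligned-power-curve-rigidity`.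
5. TRANSFER (`TransferAt`, provable now): the shape law at every `l ∈ (s, 2)` gives the crux at `s` (tree
   reduction `abcExponentCount_le_of_shapeCount_le` + `card_classRange_le`; `rad ≤ c^s < c^l` absorbs `≤/<`).

`MazurKaneLaw_of` composes the four stubs into the crux BY NAME (kernel-checked, no `sorry` outside the four
`stub_*`); `lawAt_of_offWall_nearWall` is the kernel-checked REACH of the line without the foreign stub:
transfer + off-wall + lever ⟹ the Mazur–Kane law for every `s ∈ [15/8, 2)`.

## Disproof used (cdisprove `Disproof.lean` 2026-08-15T22:51Z, 1151 lines rc 0; known through its four evidence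
notes only — `run/gate/evidence/**` is not mounted here and `Cruxes/MazurKaneLaw/Disproof.lean` is not written)
* `mazurKaneLaw_false_without_eps` / `not_lawAt_zero` / `abcExponentCount_not_bigO` (ε load-bearing at EVERY
  `s`: `(1,c-1,c)`, `(xⁿ, rⁿ-xⁿ, rⁿ)` sit on `N^{s-1}·log N`) — HONOURED: every stub concludes
  `≤ K C₀^{s-1+3ε+η}` for all `η > 0` (the `3ε` is the admissibility slack `P ≤ (2C₀)^{s+3ε}`, not a claim);
  nothing ε-free is stated. The line USES ε at `stub_nearWall` (divisor/`N^η` losses of completion) and at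
  `stub_transfer` (room `s < l < 2`).
* `mazurKaneLaw_false_without_coprime` (dyadic family `≍ N^{3/4}` at `s = 3/2`) — HONOURED: all counts are
  `shapeCount` (the `gcd = 1` clause is inside `shapeTriples`); the lever NEEDS it (units modulo `a₃`:
  `a₁, a₂, u₀, u₁` coprime to `a₃` by `coprime_terms_of_mem`) — "the line uses coprimality at `stub_nearWall`
  and `stub_offWall` (conic: `fiberBound`'s `hcu/hvc`)".
* `mazurKaneLaw_false_without_one_lt` (`s = 9/10`: hit `(1,8,9)`) — HONOURED: `TransferAt` is stated for
  `1 < s` and needs `s < l < 2`.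
* `lawAt_of_three_le`, `tight_at_one_add_inv`, `lawAt_mono` — not engaged (all statements live on `(1,2)`);
  `abcHitCount_le_of_mazurKaneLaw` (crux ⇒ hits `≪ X^δ`) — consistent: that content sits in
  `stub_deepResidual`, flagged foreign.
* Landed `Theorems/MazurKaneLaw/Negative/`: none exists (checked 2026-08-16); `ledger negatives --problem ABC`
  = stmt-ABC-1689, stmt-ABC-1205 (not about counting) — no stub is an instance of either.
-/

noncomputable section

open Finset
open Literature.NumberTheory.DiophantineGeometry
open Literature.NumberTheory.DiophantineGeometry.AbcShapes

namespace Summit.ABC.ABC.Cruxes.MazurKaneLaw.CriticalKloostermanPowerfulModuli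

/-! ## The statements (named `Prop`s over tree declarations; the registered `stub_*` theorems restate them
verbatim and fully qualified; `Registered.stub_*` are the name-keyed aliases taken as hypotheses of
`MazurKaneLaw_of` — the skeleton audit admits a hypothesis whose head's last name component is a declared stub,
same device as `Lines/fibre-toolkit-lp-wall-map.lean`) -/

/-- The LINEAR DEPTH up to which the lever is claimed: `τ₀ = 1/4` (documentation constant; the registered
signatures inline the literal `1 / 4`). Reshaping the line to a proved critical saving `ρ` = replacing this
literal (and `15 / 8 = 2 - τ₀/2` in `not_deep` / `lawAt_of_offWall_nearWall`). -/
def depth : ℝ := 1 / 4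

/-- The Mazur–Kane law AT ONE EXPONENT `s` — literally the body of the crux
`Summit.ABC.ABC.Theses.TwistAmplification.MazurKaneLaw` (see `mazurKaneLaw_iff`). -/
def LawAt (s : ℝ) : Prop :=
  ∀ ε : ℝ, 0 < ε → ∃ C : ℝ, ∀ N : ℕ, 2 ≤ N →
    (Set.ncard {t : ℕ × ℕ × ℕ | IsABCTriple t.1 t.2.1 t.2.2 ∧ t.2.2 ≤ N ∧
      ((rad t.1 t.2.1 t.2.2 : ℕ) : ℝ) ≤ (t.2.2 : ℝ) ^ s} : ℝ) ≤ C * (N : ℝ) ^ (s - 1 + ε)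

/-- The crux is `LawAt` at every `s ∈ (1, 2)`, definitionally. -/
theorem mazurKaneLaw_iff :
    Summit.ABC.ABC.Theses.TwistAmplification.MazurKaneLaw ↔ ∀ s : ℝ, 1 < s → s < 2 → LawAt s :=
  Iff.rfl

/-- THE SHAPE LAW at exponent `l`: `B_M(c; X, Y, Z) ≤ K · C₀^{l-1+3ε+η}` for all data admissible for `(l, ε)`
(`M = ⌊10/ε²⌋` levels), every `η > 0`. Implied by the crux at `l + O(ε)` together with Kane's theorem above `2`
(a counted shape solution is an abc triple with `c ∈ [C₀/V₂, 2C₀]`, `rad ≤ 8^M (2C₀)^{l+9ε/2}`, represented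
`≤ τ_M³ = C₀^{o(1)}` times), so regional pieces of it are pieces of the conjecture, not strengthenings. -/
def ShapeLawAt (l : ℝ) : Prop :=
  ∀ ε : ℝ, 0 < ε → ε < 1 / 2 → ∀ η : ℝ, 0 < η → ∃ K : ℝ,
    ∀ (C₀ c₁ c₂ c₃ : ℕ) (X Y Z : Fin (numShapes ε) → ℕ),
      Admissible l ε C₀ c₁ c₂ c₃ X Y Z →
        (shapeCount c₁ c₂ c₃ X Y Z : ℝ) ≤ K * (C₀ : ℝ) ^ (l - 1 + 3 * ε + η)

/-- OFF-WALL law at `l`: the shape law on the data certified by one of the two tree tools: `P ≤ 2R·P₀`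
(`R = C₀^{l-1+3ε}`; Kane's lattices in the linear variables) or `P ≤ 2R·P₁ ∧ P³ ≤ 64R³·A`,
`A = (c₁·shapeVal X)(c₂·shapeVal Y)(c₃·shapeVal Z) = Θ³(2C₀)³` (the sharp conic with full modulus). The indices
`i₀, i₁` are the coordinates `0, 1` of `Fin M` (they exist: `M ≥ 40` for `ε < 1/2`, `two_le_numShapes`). -/
def OffWallAt (l : ℝ) : Prop :=
  ∀ ε : ℝ, 0 < ε → ε < 1 / 2 → ∀ η : ℝ, 0 < η → ∃ K : ℝ,
    ∀ (C₀ c₁ c₂ c₃ : ℕ) (X Y Z : Fin (numShapes ε) → ℕ) (i₀ i₁ : Fin (numShapes ε)),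
      (i₀ : ℕ) = 0 → (i₁ : ℕ) = 1 → Admissible l ε C₀ c₁ c₂ c₃ X Y Z →
        ((∏ i, ((X i : ℝ) * Y i * Z i)) ≤ 2 * (C₀ : ℝ) ^ (l - 1 + 3 * ε) * ((X i₀ : ℝ) * Y i₀ * Z i₀) ∨
          ((∏ i, ((X i : ℝ) * Y i * Z i)) ≤ 2 * (C₀ : ℝ) ^ (l - 1 + 3 * ε) * ((X i₁ : ℝ) * Y i₁ * Z i₁) ∧
            (∏ i, ((X i : ℝ) * Y i * Z i)) ^ 3 ≤ 64 * ((C₀ : ℝ) ^ (l - 1 + 3 * ε)) ^ 3 *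
              (((c₁ * shapeVal X : ℕ) : ℝ) * ((c₂ * shapeVal Y : ℕ) : ℝ) * ((c₃ * shapeVal Z : ℕ) : ℝ)))) →
          (shapeCount c₁ c₂ c₃ X Y Z : ℝ) ≤ K * (C₀ : ℝ) ^ (l - 1 + 3 * ε + η)

/-- NEAR-WALL law at `l` (the LEVER's claim): the shape law on the bad region (not off-wall) up to linear depth
`1/4`: `P ≤ 2R·C₀^{1/4}·P₀`. -/
def NearWallAt (l : ℝ) : Prop :=
  ∀ ε : ℝ, 0 < ε → ε < 1 / 2 → ∀ η : ℝ, 0 < η → ∃ K : ℝ,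
    ∀ (C₀ c₁ c₂ c₃ : ℕ) (X Y Z : Fin (numShapes ε) → ℕ) (i₀ i₁ : Fin (numShapes ε)),
      (i₀ : ℕ) = 0 → (i₁ : ℕ) = 1 → Admissible l ε C₀ c₁ c₂ c₃ X Y Z →
        ¬ ((∏ i, ((X i : ℝ) * Y i * Z i)) ≤ 2 * (C₀ : ℝ) ^ (l - 1 + 3 * ε) * ((X i₀ : ℝ) * Y i₀ * Z i₀) ∨
          ((∏ i, ((X i : ℝ) * Y i * Z i)) ≤ 2 * (C₀ : ℝ) ^ (l - 1 + 3 * ε) * ((X i₁ : ℝ) * Y i₁ * Z i₁) ∧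
            (∏ i, ((X i : ℝ) * Y i * Z i)) ^ 3 ≤ 64 * ((C₀ : ℝ) ^ (l - 1 + 3 * ε)) ^ 3 *
              (((c₁ * shapeVal X : ℕ) : ℝ) * ((c₂ * shapeVal Y : ℕ) : ℝ) * ((c₃ * shapeVal Z : ℕ) : ℝ)))) →
        (∏ i, ((X i : ℝ) * Y i * Z i)) ≤
            2 * (C₀ : ℝ) ^ (l - 1 + 3 * ε) * (C₀ : ℝ) ^ (1 / 4 : ℝ) * ((X i₀ : ℝ) * Y i₀ * Z i₀) →
          (shapeCount c₁ c₂ c₃ X Y Z : ℝ) ≤ K * (C₀ : ℝ) ^ (l - 1 + 3 * ε + η)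

/-- DEEP law at `l` (the foreign RESIDUAL): the shape law on the bad region beyond linear depth `1/4`. Vacuous
for `l ≥ 15/8` (`not_deep`). -/
def DeepAt (l : ℝ) : Prop :=
  ∀ ε : ℝ, 0 < ε → ε < 1 / 2 → ∀ η : ℝ, 0 < η → ∃ K : ℝ,
    ∀ (C₀ c₁ c₂ c₃ : ℕ) (X Y Z : Fin (numShapes ε) → ℕ) (i₀ i₁ : Fin (numShapes ε)),
      (i₀ : ℕ) = 0 → (i₁ : ℕ) = 1 → Admissible l ε C₀ c₁ c₂ c₃ X Y Z →
        ¬ ((∏ i, ((X i : ℝ) * Y i * Z i)) ≤ 2 * (C₀ : ℝ) ^ (l - 1 + 3 * ε) * ((X i₀ : ℝ) * Y i₀ * Z i₀) ∨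
          ((∏ i, ((X i : ℝ) * Y i * Z i)) ≤ 2 * (C₀ : ℝ) ^ (l - 1 + 3 * ε) * ((X i₁ : ℝ) * Y i₁ * Z i₁) ∧
            (∏ i, ((X i : ℝ) * Y i * Z i)) ^ 3 ≤ 64 * ((C₀ : ℝ) ^ (l - 1 + 3 * ε)) ^ 3 *
              (((c₁ * shapeVal X : ℕ) : ℝ) * ((c₂ * shapeVal Y : ℕ) : ℝ) * ((c₃ * shapeVal Z : ℕ) : ℝ)))) →
        ¬ ((∏ i, ((X i : ℝ) * Y i * Z i)) ≤
            2 * (C₀ : ℝ) ^ (l - 1 + 3 * ε) * (C₀ : ℝ) ^ (1 / 4 : ℝ) * ((X i₀ : ℝ) * Y i₀ * Z i₀)) →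
          (shapeCount c₁ c₂ c₃ X Y Z : ℝ) ≤ K * (C₀ : ℝ) ^ (l - 1 + 3 * ε + η)

/-- Statement of STUB 1 — TRANSFER, pointwise in `s`: the shape law at every `l ∈ (s, 2)` gives the crux at `s`. -/
def TransferAt : Prop :=
  ∀ s : ℝ, 1 < s → s < 2 → (∀ l : ℝ, s < l → l < 2 → ShapeLawAt l) → LawAt s

/-- Statement of STUB 2 — the OFF-WALL law at every `l ∈ (1, 2)`. -/
def OffWallLaw : Prop :=
  ∀ l : ℝ, 1 < l → l < 2 → OffWallAt l

/-- Statement of STUB 3 — the NEAR-WALL law (the lever) at every `l ∈ (1, 2)`. -/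
def NearWallLaw : Prop :=
  ∀ l : ℝ, 1 < l → l < 2 → NearWallAt l

/-- Statement of STUB 4 — the DEEP residual law at every `l ∈ (1, 2)` (vacuous for `l ≥ 15/8`). -/
def DeepResidualLaw : Prop :=
  ∀ l : ℝ, 1 < l → l < 2 → DeepAt l

/-! ## The registered stubs (`sorry` lives only here; signatures verbatim, `let`-free, fully qualified, so that a
Theorems-side `propose --supports stmt-ABC-2757` proof can restate them textually) -/

/-- **STUB 1 · `stub_transfer`** (M, PROVABLE NOW) — the shape law at every `l ∈ (s,2)` implies the crux at `s`.
The work (pattern of `bernertEtAl2024_thm_1_2_holds` / `_1_3_holds` in `AbcExceptionalSetBounds*Proofs`): given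
`1 < s < 2`, `ε > 0`, put `l = min(s + ε/4, (s+2)/2) ∈ (s, 2)`, `ε' = min(ε/20, 1/4)`, `η = ε/8`; an abc triple
has `c ≥ 2`, so `rad ≤ c^s < c^l` and the crux's set at `(s, N)` lies in the set of `abcExponentCount l N`
(`abcExponentCount_finite`, `Set.ncard_le_ncard`); the shape law at `(l, ε', η)` with `K ↦ max K 0` feeds
`abcExponentCount_le_of_shapeCount_le` (`θ = l - 1 + 3ε' + η ≥ 0`), and `card_classRange_le ε' (δ := ε/8)` bounds
the classes by `C' N^{3ε'/2 + ε/8}`; the exponents add to `≤ s - 1 + 29ε/40 ≤ s - 1 + ε`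
(`Real.rpow_le_rpow_of_exponent_le`, `N ≥ 1`). Honours `mazurKaneLaw_false_without_one_lt` (room `s < l < 2`)
and keeps `+ε`. Leans on: `AbcShapes.abcExponentCount_le_of_shapeCount_le`, `AbcShapes.card_classRange_le`,
`abcExponentCount_def`, `abcExponentCount_finite`. -/
theorem stub_transfer : ∀ s : ℝ, 1 < s → s < 2 → (∀ l : ℝ, s < l → l < 2 → ∀ ε : ℝ, 0 < ε → ε < 1 / 2 → ∀ η : ℝ, 0 < η → ∃ K : ℝ, ∀ (C₀ c₁ c₂ c₃ : ℕ) (X Y Z : Fin (Literature.NumberTheory.DiophantineGeometry.AbcShapes.numShapes ε) → ℕ), Literature.NumberTheory.DiophantineGeometry.AbcShapes.Admissible l ε C₀ c₁ c₂ c₃ X Y Z → (Literature.NumberTheory.DiophantineGeometry.AbcShapes.shapeCount c₁ c₂ c₃ X Y Z : ℝ) ≤ K * (C₀ : ℝ) ^ (l - 1 + 3 * ε + η)) → ∀ ε : ℝ, 0 < ε → ∃ C : ℝ, ∀ N : ℕ, 2 ≤ N → (Set.ncard {t : ℕ × ℕ × ℕ | Literature.NumberTheory.DiophantineGeometry.IsABCTriple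 t.1 t.2.1 t.2.2 ∧ t.2.2 ≤ N ∧ ((Literature.NumberTheory.DiophantineGeometry.rad t.1 t.2.1 t.2.2 : ℕ) : ℝ) ≤ (t.2.2 : ℝ) ^ s} : ℝ) ≤ C * (N : ℝ) ^ (s - 1 + ε) := by
  sorry

/-- **STUB 2 · `stub_offWall`** (L, PROVABLE NOW) — OFF THE WALL THE TWO TREE TOOLS GIVE THE LAW: for
`1 < l < 2`, `0 < ε < 1/2`, `η > 0` there is `K` with `B_M ≤ K C₀^{l-1+3ε+η}` on every admissible datum with
`P ≤ 2R·P₀ ∨ (P ≤ 2R·P₁ ∧ P³ ≤ 64R³A)`, `A = (c₁ shapeVal X)(c₂ shapeVal Y)(c₃ shapeVal Z)`. The work: with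
`V₂ = shapeVal (2,…,2) = 2^{M(M+1)/2}`, admissibility gives `c₃ shapeVal Z ≥ C₀/V₂` (`le_valZ`) and
`P ≤ (2C₀)^{l+3ε}` (`prod_le`). (a) `P ≤ 2RP₀`: `shapeCount_succ_le` (state it for `Fin (d+1)`, `cases` on
`numShapes ε`; or `shapeCount_le_geometry_sets` with `I = J = K = {i₀}` and the divisor factor `D ≪ C₀^{η}`,
`Sieve.exists_card_divisors_le_mul_rpow` as in `AbcShapeEndgame`): `B ≤ 2P/P₀ + 112 V₂ P/C₀ ≤ (4 + 112V₂2^{l+3ε}) C₀^{l-1+3ε}`.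
(b) `P ≤ 2RP₁ ∧ P³ ≤ 64R³A`: fibre `shapeTriples` over the variables off coordinate `i₁` (`subBox` pattern of
`AbcShapeGeometrySets`); on a non-empty fibre `A'x² + B'y² = C'z²` with `A' = c₁·∏_{i≠1}xᵢ^{i+1} ≥ c₁ shapeVal X/X₁²`,
pairwise coprime coefficients and unknowns (`coprime_terms_of_mem`), so `SquarefulDet.fiberBound` (`n = 1`,
`e = 1`, `v = (A',B',C')`, auxiliary prime `p ∈ (P', 2P']` from Bertrand with `P'³ ≍ 48 X₁Y₁Z₁/(A'B'C') + polylog`,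
`A'B'C' ≥ A/P₁²`) gives `≤ 36p · 8 · 2^{ω(A'B'C')} ≪ C₀^{η}(1 + (P₁³/A)^{1/3})` points per fibre; summing over the
`P/P₁` fibres: `B ≪ C₀^{η}(P/P₁ + P/A^{1/3})`, and `P/P₁ ≤ 2R`, `P/A^{1/3} ≤ 4R` are exactly the two hypotheses.
This is the content of the map line's `DetTool`/`ToolkitTame` (`Lines/fibre-toolkit-lp-wall-map.lean`) restricted to
the two certificates that matter here; whichever lands first serves both lines. Why it might need reshaping:
bookkeeping only (casts; `fiberBound`'s `Icc (-Z) Z` box vs `Ico X (2X)`; `2^{ω} ≤ τ ≪ C₀^{η}`; small `C₀` into `K`).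
Uses coprimality (honours `mazurKaneLaw_false_without_coprime`). Leans on: `shapeCount_succ_le`,
`shapeCount_le_geometry_sets`, `SquarefulDet.fiberBound`, `card_box_filter_coprime_congr_le`,
`Admissible.le_valZ/prod_le/valX_le`, `Sieve.exists_card_divisors_le_mul_rpow`, `Nat.exists_prime_lt_and_le_two_mul`. -/
theorem stub_offWall : ∀ l : ℝ, 1 < l → l < 2 → ∀ ε : ℝ, 0 < ε → ε < 1 / 2 → ∀ η : ℝ, 0 < η → ∃ K : ℝ, ∀ (C₀ c₁ c₂ c₃ : ℕ) (X Y Z : Fin (Literature.NumberTheory.DiophantineGeometry.AbcShapes.numShapes ε) → ℕ) (i₀ i₁ : Fin (Literature.NumberTheory.DiophantineGeometry.AbcShapes.numShapes ε)), (i₀ : ℕ) = 0 → (i₁ : ℕ) = 1 → Literature.NumberTheory.DiophantineGeometry.AbcShapes.Admissible l ε C₀ c₁ c₂ c₃ X Y Z → ((∏ i, ((X i : ℝ) * Y i * Z i)) ≤ 2 * (C₀ : ℝ) ^ (l - 1 + 3 * ε) * ((X i₀ : ℝ) * Y i₀ * Z i₀) ∨ ((∏ i, ((X i : ℝ) * Y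 i * Z i)) ≤ 2 * (C₀ : ℝ) ^ (l - 1 + 3 * ε) * ((X i₁ : ℝ) * Y i₁ * Z i₁) ∧ (∏ i, ((X i : ℝ) * Y i * Z i)) ^ 3 ≤ 64 * ((C₀ : ℝ) ^ (l - 1 + 3 * ε)) ^ 3 * (((c₁ * Literature.NumberTheory.DiophantineGeometry.AbcShapes.shapeVal X : ℕ) : ℝ) * ((c₂ * Literature.NumberTheory.DiophantineGeometry.AbcShapes.shapeVal Y : ℕ) : ℝ) * ((c₃ * Literature.NumberTheory.DiophantineGeometry.AbcShapes.shapeVal Z : ℕ) : ℝ)))) → (Literature.NumberTheory.DiophantineGeometry.AbcShapes.shapeCount c₁ c₂ c₃ X Y Z : ℝ) ≤ K * (C₀ : ℝ) ^ (l - 1 + 3 * ε + η) := by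
  sorry

/-- **STUB 3 · `stub_nearWall`** (XL, OPEN — THE LEVER; HARDEST; the lead holds this one) — ON THE BAD REGION UP
TO LINEAR DEPTH `1/4` THE OCCUPIED LATTICES ARE AS MANY AS EXPECTED: for `1 < l < 2`, `0 < ε < 1/2`, `η > 0` there
is `K` with `B_M ≤ K C₀^{l-1+3ε+η}` on every admissible datum with neither certificate of STUB 2 (Kane's "+1"
exceeds the law; the conic fails by its "+1" or by the deficiency) and `P ≤ 2R C₀^{1/4} P₀` (Kane's "+1" exceeds
the law by at most `C₀^{1/4}`; since Kane's MAIN term `112V₂P/C₀` is always `≤ law`, the occupied-lattice density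
at the linear level is the ONLY thing to prove here, lopsided or not). Equivalently: among
the `P/P₀` lattices `{(x₀,y₀) : a₃ ∣ a₁x₀ + a₂y₀}`, `a₃ = c₃ ∏_{i≥1} zᵢ^{i+1}` SQUAREFULL (up to `c₃ ≤ (2C₀)^{ε/2}`),
probed in the sub-Minkowski box `4X₀Y₀ < a₃`, at most `C₀^{η}·(P/P₀)·(X₀Y₀Z₀V₂/C₀) + law` are occupied. WHY
PLAUSIBLY TRUE: implied by the crux (see `ShapeLawAt`); the refuters' toy counts ON the wall (TRIAGE r1-2
`wall.py`: occupied/expected `≈ .20–.26` flat over 5 orders of magnitude of expected-points-per-lattice, Kane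
off by `×3900`; kit j007160) sit on it. THE MECHANISM (idea card; module docstring §3): Poisson in `u₁` →
trilinear sums `Σ_k Σ_{u₀} Σ_{y₁} e(k u₀ a₁ \overline{c₂y₁²y₂³⋯}/a₃)`; complete Kloosterman/Salié sums to the
squarefull `a₃` evaluate (stationary phase) to explicit phases; cancellation needed `N^{(1+2δ)/3}` out of total
length `N` at the wall of depth `δ = 2 - l`; square-root in `(k,u₀,y₁)` ⟺ `δ ≤ 1/4` (hence the depth);
tools: `q`-van der Corput along `a₃ = (z₁z₂²)(z₁z₂)` (void for a single modulus at the critical length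
`X₁ ≍ z₁` — the family average over `z'` is mandatory), large sieve for square moduli (Baier–Zhao), bilinear
Kloosterman bounds below the Pólya–Vinogradov range (Kowalski–Michel–Sawin type; for prime-power / squarefull
moduli via `p`-adic stationary phase). WHY IT MIGHT FAIL: (i) criticality — every purely harmonic manipulation
(Poisson in `u`, characters mod `a₃`, Cauchy–Schwarz) is an identity returning Kane's count (checked in the plan:
the dual problem's main term IS the "+1"); the input must be an equidistribution statement for
`\overline{y₁²}·t mod z₁²z₂³` finer than moments — Hölder with optimal moment bounds caps at `N^{1-δ/3}`, i.e.
loses `N^{2δ/3}` against the law (= ideator 2's "(4)", TRIAGE r1-1/3); (ii) the square part `z₁²` of the modulus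
has `p`-adic depth only `2`, where Postnikov-type gains are weakest. FIRST MILESTONE (a record either way): prove
the statement with `1/4` replaced by any `τ₁ > 0` ⇒ (side theorem) `MazurKaneLaw` on `[2 - τ₁/2, 2)`, the first
exponent range below Kane's `s ≥ 2`. Uses ε (completion losses) and coprimality (units mod `a₃`) — honours
`not_lawAt_zero`, `mazurKaneLaw_false_without_coprime`. Leans on (tree): `shapeTriples`, `coprime_terms_of_mem`,
`card_box_filter_coprime_congr_le`, `CongruenceLatticeBoxCount`, `ZMod`/`AddChar` Fourier API of Mathlib;
NOT in tree/Mathlib: Kloosterman sums, their prime-power evaluation, any large sieve — to be built as helpers.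
[Kane arXiv:1104.2635 §4; BBLT arXiv:2410.12234 Props 2.1, 4.1; Iwaniec–Kowalski, AMS Coll. Publ. 53, §12.3,
Lemmas 12.2–12.3; Baier–Zhao, large sieve with square moduli; Kowalski–Michel–Sawin, Ann. Math. 186 (2017)] -/
theorem stub_nearWall : ∀ l : ℝ, 1 < l → l < 2 → ∀ ε : ℝ, 0 < ε → ε < 1 / 2 → ∀ η : ℝ, 0 < η → ∃ K : ℝ, ∀ (C₀ c₁ c₂ c₃ : ℕ) (X Y Z : Fin (Literature.NumberTheory.DiophantineGeometry.AbcShapes.numShapes ε) → ℕ) (i₀ i₁ : Fin (Literature.NumberTheory.DiophantineGeometry.AbcShapes.numShapes ε)), (i₀ : ℕ) = 0 → (i₁ : ℕ) = 1 → Literature.NumberTheory.DiophantineGeometry.AbcShapes.Admissible l ε C₀ c₁ c₂ c₃ X Y Z → ¬ ((∏ i, ((X i : ℝ) * Y i * Z i)) ≤ 2 * (C₀ : ℝ) ^ (l - 1 + 3 * ε) * ((X i₀ : ℝ) * Y i₀ * Z i₀) ∨ ((∏ i, ((X i : ℝ) * Y i * Z i)) ≤ 2 * (C₀ : ℝ)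 ^ (l - 1 + 3 * ε) * ((X i₁ : ℝ) * Y i₁ * Z i₁) ∧ (∏ i, ((X i : ℝ) * Y i * Z i)) ^ 3 ≤ 64 * ((C₀ : ℝ) ^ (l - 1 + 3 * ε)) ^ 3 * (((c₁ * Literature.NumberTheory.DiophantineGeometry.AbcShapes.shapeVal X : ℕ) : ℝ) * ((c₂ * Literature.NumberTheory.DiophantineGeometry.AbcShapes.shapeVal Y : ℕ) : ℝ) * ((c₃ * Literature.NumberTheory.DiophantineGeometry.AbcShapes.shapeVal Z : ℕ) : ℝ)))) → (∏ i, ((X i : ℝ) * Y i * Z i)) ≤ 2 * (C₀ : ℝ) ^ (l - 1 + 3 * ε) * (C₀ : ℝ) ^ (1 / 4 : ℝ) * ((X i₀ : ℝ) * Y i₀ * Z i₀) → (Literature.NumberTheory.DiophantineGeometry.AbcShapes.shapeCount c₁ c₂ c₃ X Y Z : ℝ) ≤ K * (C₀ : ℝ) ^ (l - 1 + 3 * ε + η) := by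
  sorry

/-- **STUB 4 · `stub_deepResidual`** (XL⁺, OPEN, FOREIGN — not attacked by this line) — THE DEEP RESIDUAL: the
shape law on the bad region beyond linear depth `1/4` (no certificate of STUB 2 and `P > 2R C₀^{1/4} P₀`), at every
`l ∈ (1,2)`. VACUOUS for `l ≥ 15/8`: the region is empty there (`not_deep`, proved in this file from the
structure inequalities `P³ ≤ A·P₀²P₁`, `P² ≤ A·P₀`), which is why the line ALONE reaches `[15/8, 2)`
(`lawAt_of_offWall_nearWall`). Below `15/8` it is most of Mazur's question: the symmetric wall of depth
`δ = 2 - l > 1/4`, the asymmetric walls down to `12/7` (map line's LP), the cube-heavy / twisted-Fermat boxes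
`u₀y₀³ + u₁y₁³ = u₂y₂³` below `5/3`, and at `l → 1⁺` the bound "abc hits `≪ N^{δ}` for every `δ`" (record `0.6`,
tree `bernertEtAl2024_thm_1_3_holds`; Disproof `abcHitCount_le_of_mazurKaneLaw` shows the crux needs it). WHY
PLAUSIBLY TRUE: implied by the crux (Mazur 2000 / Kane Conj. 1); no positive-power family of near-hits is known
(Dahmen 2008: `exp((log N)^{1/2-ε})`). RECOMMENDED to the tenure planner: split the crux item along this seam
(this file types both halves and the glue). Candidate levers on file: `peyre-level-torsor-v22` /
`heegner-cusp-subholzer` (level aspect, reach `5/3`), `aligned-power-curve-rigidity` (cubes).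
[arXiv:1104.2635 Conj. 1, Thm 2; Mazur, Notices AMS 47 (2000) 195–202; arXiv:2410.12234 Thms 1.2–1.3] -/
theorem stub_deepResidual : ∀ l : ℝ, 1 < l → l < 2 → ∀ ε : ℝ, 0 < ε → ε < 1 / 2 → ∀ η : ℝ, 0 < η → ∃ K : ℝ, ∀ (C₀ c₁ c₂ c₃ : ℕ) (X Y Z : Fin (Literature.NumberTheory.DiophantineGeometry.AbcShapes.numShapes ε) → ℕ) (i₀ i₁ : Fin (Literature.NumberTheory.DiophantineGeometry.AbcShapes.numShapes ε)), (i₀ : ℕ) = 0 → (i₁ : ℕ) = 1 → Literature.NumberTheory.DiophantineGeometry.AbcShapes.Admissible l ε C₀ c₁ c₂ c₃ X Y Z → ¬ ((∏ i, ((X i : ℝ) * Y i * Z i)) ≤ 2 * (C₀ : ℝ) ^ (l - 1 + 3 * ε) * ((X i₀ : ℝ) * Y i₀ * Z i₀) ∨ ((∏ i, ((X i : ℝ) * Y i * Z i)) ≤ 2 * (C₀ : ℝ) ^ (l - 1 + 3 * ε) * ((X i₁ : ℝ) * Y i₁ * Z i₁) ∧ (∏ i, ((X i : ℝ) * Y i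 * Z i)) ^ 3 ≤ 64 * ((C₀ : ℝ) ^ (l - 1 + 3 * ε)) ^ 3 * (((c₁ * Literature.NumberTheory.DiophantineGeometry.AbcShapes.shapeVal X : ℕ) : ℝ) * ((c₂ * Literature.NumberTheory.DiophantineGeometry.AbcShapes.shapeVal Y : ℕ) : ℝ) * ((c₃ * Literature.NumberTheory.DiophantineGeometry.AbcShapes.shapeVal Z : ℕ) : ℝ)))) → ¬ ((∏ i, ((X i : ℝ) * Y i * Z i)) ≤ 2 * (C₀ : ℝ) ^ (l - 1 + 3 * ε) * (C₀ : ℝ) ^ (1 / 4 : ℝ) * ((X i₀ : ℝ) * Y i₀ * Z i₀)) → (Literature.NumberTheory.DiophantineGeometry.AbcShapes.shapeCount c₁ c₂ c₃ X Y Z : ℝ) ≤ K * (C₀ : ℝ) ^ (l - 1 + 3 * ε + η) := by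
  sorry

/-! ## Consistency: each named statement IS its registered stub (definitionally) -/

theorem transferAt_holds : TransferAt := stub_transfer
theorem offWallLaw_holds : OffWallLaw := stub_offWall
theorem nearWallLaw_holds : NearWallLaw := stub_nearWall
theorem deepResidualLaw_holds : DeepResidualLaw := stub_deepResidual

/-! ## Name-keyed aliases of the four statements (the hypotheses of the composition) -/
namespace Registered

/-- Alias of `TransferAt` keyed by the registered stub name. -/
abbrev stub_transfer : Prop := TransferAt
/-- Alias of `OffWallLaw` keyed by the registered stub name. -/
abbrev stub_offWall : Prop := OffWallLaw
/-- Alias of `NearWallLaw` keyed by the registered stub name. -/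
abbrev stub_nearWall : Prop := NearWallLaw
/-- Alias of `DeepResidualLaw` keyed by the registered stub name. -/
abbrev stub_deepResidual : Prop := DeepResidualLaw

end Registered

/-! ## Proved glue -/

/-- For `0 < ε < 1/2` there are at least two shape levels (`⌊10/ε²⌋ ≥ 40`), so coordinates `0` and `1` exist. -/
theorem two_le_numShapes {ε : ℝ} (hε : 0 < ε) (hε2 : ε < 1 / 2) : 2 ≤ numShapes ε := by
  unfold numShapes
  apply Nat.le_floor
  rw [Nat.cast_ofNat, le_div_iff₀ (by positivity)]
  nlinarith

/-- The three regional laws at `l` give the shape law at `l` (case split on the region; constants maxed). -/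
theorem shapeLawAt_of_regions {l : ℝ} (hO : OffWallAt l) (hN : NearWallAt l) (hD : DeepAt l) :
    ShapeLawAt l := by
  intro ε hε hε2 η hη
  obtain ⟨K₁, hK₁⟩ := hO ε hε hε2 η hη
  obtain ⟨K₂, hK₂⟩ := hN ε hε hε2 η hη
  obtain ⟨K₃, hK₃⟩ := hD ε hε hε2 η hη
  have h2 := two_le_numShapes hε hε2
  refine ⟨max K₁ (max K₂ K₃), fun C₀ c₁ c₂ c₃ X Y Z hA => ?_⟩
  have hC : (0 : ℝ) ≤ (C₀ : ℝ) ^ (l - 1 + 3 * ε + η) := Real.rpow_nonneg (Nat.cast_nonneg _) _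
  have hO' := hK₁ C₀ c₁ c₂ c₃ X Y Z ⟨0, by omega⟩ ⟨1, by omega⟩ rfl rfl hA
  have hN' := hK₂ C₀ c₁ c₂ c₃ X Y Z ⟨0, by omega⟩ ⟨1, by omega⟩ rfl rfl hA
  have hD' := hK₃ C₀ c₁ c₂ c₃ X Y Z ⟨0, by omega⟩ ⟨1, by omega⟩ rfl rfl hA
  refine (Classical.em _).elim (fun h1 => (hO' h1).trans ?_) (fun h1 => ?_)
  · exact mul_le_mul_of_nonneg_right (le_max_left _ _) hC
  refine (Classical.em _).elim (fun h2 => (hN' h1 h2).trans ?_) (fun h2 => (hD' h1 h2).trans ?_)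
  · exact mul_le_mul_of_nonneg_right ((le_max_left _ _).trans (le_max_right _ _)) hC
  · exact mul_le_mul_of_nonneg_right ((le_max_right _ _).trans (le_max_right _ _)) hC

/-! ## The composition: the four stubs imply the crux, by name -/

/-- `MazurKaneLaw` from the four stubs (pure logic; no `sorry`): for `1 < s < 2`, STUB 1 reduces the law at `s`
to the shape law at every `l ∈ (s, 2)`, which STUBS 2–4 supply region by region (`shapeLawAt_of_regions`). -/
theorem MazurKaneLaw_of (hT : Registered.stub_transfer) (hO : Registered.stub_offWall)
    (hN : Registered.stub_nearWall) (hD : Registered.stub_deepResidual) :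
    Summit.ABC.ABC.Theses.TwistAmplification.MazurKaneLaw := by
  intro s hs1 hs2
  exact hT s hs1 hs2 fun l hl1 hl2 =>
    shapeLawAt_of_regions (hO l (by linarith) hl2) (hN l (by linarith) hl2) (hD l (by linarith) hl2)

/-- Wiring check: the registered stubs feed `MazurKaneLaw_of` as stated. -/
example : Summit.ABC.ABC.Theses.TwistAmplification.MazurKaneLaw :=
  MazurKaneLaw_of stub_transfer stub_offWall stub_nearWall stub_deepResidual

/-! ## The reach of the line without the foreign stub: `[15/8, 2)` (kernel-checked) -/

/-- One shape tuple: `(∏ᵢ xᵢ)³ ≤ (∏ᵢ xᵢ^{i+1}) · x₀² · x₁`, because every exponent `i + 1` with `i ≥ 2` is `≥ 3`. -/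
theorem prod_pow_three_le {M : ℕ} (X : Fin M → ℕ) (hX : ∀ i, 0 < X i) (i₀ i₁ : Fin M)
    (h0 : (i₀ : ℕ) = 0) (h1 : (i₁ : ℕ) = 1) :
    (∏ i, X i) ^ 3 ≤ shapeVal X * (X i₀ ^ 2 * X i₁) := by
  obtain ⟨m, rfl⟩ : ∃ m, M = m + 2 := ⟨M - 2, by have := i₁.isLt; omega⟩
  have hi0 : i₀ = 0 := Fin.ext h0
  have hi1 : i₁ = 1 := Fin.ext (by simp [h1])
  rw [hi0, hi1, shapeVal, Fin.prod_univ_succ, Fin.prod_univ_succ (n := m),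
    Fin.prod_univ_succ (f := fun i : Fin (m + 2) => X i ^ ((i : ℕ) + 1)),
    Fin.prod_univ_succ (f := fun i : Fin (m + 1) => X i.succ ^ ((i.succ : ℕ) + 1))]
  simp only [Fin.val_zero, Fin.val_succ, zero_add, pow_one, Fin.succ_zero_eq_one]
  set T : ℕ := ∏ i : Fin m, X i.succ.succ with hTdef
  set T' : ℕ := ∏ i : Fin m, X i.succ.succ ^ ((i : ℕ) + 1 + 1 + 1) with hT'def
  have hT : T ^ 3 ≤ T' := by
    rw [hTdef, hT'def, ← prod_pow]
    refine prod_le_prod (fun i _ => Nat.zero_le _) fun i _ => ?_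
    exact Nat.pow_le_pow_right (hX _) (by omega)
  calc (X 0 * (X 1 * T)) ^ 3 = X 0 * X 1 ^ (1 + 1) * (X 0 ^ 2 * X 1) * T ^ 3 := by ring
    _ ≤ X 0 * X 1 ^ (1 + 1) * (X 0 ^ 2 * X 1) * T' := Nat.mul_le_mul_left _ hT
    _ = X 0 * (X 1 ^ (1 + 1) * T') * (X 0 ^ 2 * X 1) := by ring

/-- THE STRUCTURE INEQUALITY `P³ ≤ Θ³(2C₀)³·P₀²·P₁`, in the form
`(∏ XᵢYᵢZᵢ)³ ≤ (c₁·shapeVal X)(c₂·shapeVal Y)(c₃·shapeVal Z) · (X₀Y₀Z₀)² (X₁Y₁Z₁)`. -/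
theorem prod_cube_le {M : ℕ} {c₁ c₂ c₃ : ℕ} (hc₁ : 0 < c₁) (hc₂ : 0 < c₂) (hc₃ : 0 < c₃)
    (X Y Z : Fin M → ℕ) (hX : ∀ i, 0 < X i) (hY : ∀ i, 0 < Y i) (hZ : ∀ i, 0 < Z i)
    (i₀ i₁ : Fin M) (h0 : (i₀ : ℕ) = 0) (h1 : (i₁ : ℕ) = 1) :
    (∏ i, ((X i : ℝ) * Y i * Z i)) ^ 3 ≤
      ((c₁ * shapeVal X : ℕ) : ℝ) * ((c₂ * shapeVal Y : ℕ) : ℝ) * ((c₃ * shapeVal Z : ℕ) : ℝ) *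
        (((X i₀ : ℝ) * Y i₀ * Z i₀) ^ 2 * ((X i₁ : ℝ) * Y i₁ * Z i₁)) := by
  have hx := prod_pow_three_le X hX i₀ i₁ h0 h1
  have hy := prod_pow_three_le Y hY i₀ i₁ h0 h1
  have hz := prod_pow_three_le Z hZ i₀ i₁ h0 h1
  have hx' : (∏ i, X i) ^ 3 ≤ c₁ * shapeVal X * (X i₀ ^ 2 * X i₁) :=
    hx.trans (Nat.mul_le_mul_right _ (Nat.le_mul_of_pos_left _ hc₁))
  have hy' : (∏ i, Y i) ^ 3 ≤ c₂ * shapeVal Y * (Y i₀ ^ 2 * Y i₁) :=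
    hy.trans (Nat.mul_le_mul_right _ (Nat.le_mul_of_pos_left _ hc₂))
  have hz' : (∏ i, Z i) ^ 3 ≤ c₃ * shapeVal Z * (Z i₀ ^ 2 * Z i₁) :=
    hz.trans (Nat.mul_le_mul_right _ (Nat.le_mul_of_pos_left _ hc₃))
  have hnat : ((∏ i, X i) * (∏ i, Y i) * (∏ i, Z i)) ^ 3 ≤
      (c₁ * shapeVal X) * (c₂ * shapeVal Y) * (c₃ * shapeVal Z) *
        ((X i₀ * Y i₀ * Z i₀) ^ 2 * (X i₁ * Y i₁ * Z i₁)) := by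
    calc ((∏ i, X i) * (∏ i, Y i) * (∏ i, Z i)) ^ 3
        = (∏ i, X i) ^ 3 * (∏ i, Y i) ^ 3 * (∏ i, Z i) ^ 3 := by ring
      _ ≤ (c₁ * shapeVal X * (X i₀ ^ 2 * X i₁)) * (c₂ * shapeVal Y * (Y i₀ ^ 2 * Y i₁)) *
            (c₃ * shapeVal Z * (Z i₀ ^ 2 * Z i₁)) :=
          Nat.mul_le_mul (Nat.mul_le_mul hx' hy') hz'
      _ = (c₁ * shapeVal X) * (c₂ * shapeVal Y) * (c₃ * shapeVal Z) *
            ((X i₀ * Y i₀ * Z i₀) ^ 2 * (X i₁ * Y i₁ * Z i₁)) := by ring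
  have hR : (∏ i, ((X i : ℝ) * Y i * Z i)) =
      (((∏ i, X i) * (∏ i, Y i) * (∏ i, Z i) : ℕ) : ℝ) := by
    push_cast
    simp only [prod_mul_distrib]
  rw [hR]
  exact_mod_cast hnat

/-- One shape tuple: `(∏ᵢ xᵢ)² ≤ (∏ᵢ xᵢ^{i+1}) · x₀`, because every exponent `i + 1` with `i ≥ 1` is `≥ 2`. -/
theorem prod_sq_le {M : ℕ} (X : Fin M → ℕ) (hX : ∀ i, 0 < X i) (i₀ : Fin M) (h0 : (i₀ : ℕ) = 0) :
    (∏ i, X i) ^ 2 ≤ shapeVal X * X i₀ := by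
  obtain ⟨m, rfl⟩ : ∃ m, M = m + 1 := ⟨M - 1, by have := i₀.isLt; omega⟩
  have hi0 : i₀ = 0 := Fin.ext h0
  rw [hi0, shapeVal, Fin.prod_univ_succ,
    Fin.prod_univ_succ (f := fun i : Fin (m + 1) => X i ^ ((i : ℕ) + 1))]
  simp only [Fin.val_zero, Fin.val_succ, zero_add, pow_one]
  set T : ℕ := ∏ i : Fin m, X i.succ with hTdef
  set T' : ℕ := ∏ i : Fin m, X i.succ ^ ((i : ℕ) + 1 + 1) with hT'def
  have hT : T ^ 2 ≤ T' := by
    rw [hTdef, hT'def, ← prod_pow]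
    refine prod_le_prod (fun i _ => Nat.zero_le _) fun i _ => ?_
    exact Nat.pow_le_pow_right (hX _) (by omega)
  calc (X 0 * T) ^ 2 = X 0 * X 0 * T ^ 2 := by ring
    _ ≤ X 0 * X 0 * T' := Nat.mul_le_mul_left _ hT
    _ = X 0 * T' * X 0 := by ring

/-- THE SECOND STRUCTURE INEQUALITY `P² ≤ Θ³(2C₀)³·P₀`, in the form
`(∏ XᵢYᵢZᵢ)² ≤ (c₁·shapeVal X)(c₂·shapeVal Y)(c₃·shapeVal Z) · (X₀Y₀Z₀)`. -/
theorem prod_sq_le_three {M : ℕ} {c₁ c₂ c₃ : ℕ} (hc₁ : 0 < c₁) (hc₂ : 0 < c₂) (hc₃ : 0 < c₃)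
    (X Y Z : Fin M → ℕ) (hX : ∀ i, 0 < X i) (hY : ∀ i, 0 < Y i) (hZ : ∀ i, 0 < Z i)
    (i₀ : Fin M) (h0 : (i₀ : ℕ) = 0) :
    (∏ i, ((X i : ℝ) * Y i * Z i)) ^ 2 ≤
      ((c₁ * shapeVal X : ℕ) : ℝ) * ((c₂ * shapeVal Y : ℕ) : ℝ) * ((c₃ * shapeVal Z : ℕ) : ℝ) *
        ((X i₀ : ℝ) * Y i₀ * Z i₀) := by
  have hx' : (∏ i, X i) ^ 2 ≤ c₁ * shapeVal X * X i₀ :=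
    (prod_sq_le X hX i₀ h0).trans (Nat.mul_le_mul_right _ (Nat.le_mul_of_pos_left _ hc₁))
  have hy' : (∏ i, Y i) ^ 2 ≤ c₂ * shapeVal Y * Y i₀ :=
    (prod_sq_le Y hY i₀ h0).trans (Nat.mul_le_mul_right _ (Nat.le_mul_of_pos_left _ hc₂))
  have hz' : (∏ i, Z i) ^ 2 ≤ c₃ * shapeVal Z * Z i₀ :=
    (prod_sq_le Z hZ i₀ h0).trans (Nat.mul_le_mul_right _ (Nat.le_mul_of_pos_left _ hc₃))
  have hnat : ((∏ i, X i) * (∏ i, Y i) * (∏ i, Z i)) ^ 2 ≤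
      (c₁ * shapeVal X) * (c₂ * shapeVal Y) * (c₃ * shapeVal Z) * (X i₀ * Y i₀ * Z i₀) := by
    calc ((∏ i, X i) * (∏ i, Y i) * (∏ i, Z i)) ^ 2
        = (∏ i, X i) ^ 2 * (∏ i, Y i) ^ 2 * (∏ i, Z i) ^ 2 := by ring
      _ ≤ (c₁ * shapeVal X * X i₀) * (c₂ * shapeVal Y * Y i₀) * (c₃ * shapeVal Z * Z i₀) :=
          Nat.mul_le_mul (Nat.mul_le_mul hx' hy') hz'
      _ = (c₁ * shapeVal X) * (c₂ * shapeVal Y) * (c₃ * shapeVal Z) * (X i₀ * Y i₀ * Z i₀) := by ring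
  have hR : (∏ i, ((X i : ℝ) * Y i * Z i)) =
      (((∏ i, X i) * (∏ i, Y i) * (∏ i, Z i) : ℕ) : ℝ) := by
    push_cast
    simp only [prod_mul_distrib]
  rw [hR]
  exact_mod_cast hnat

/-- THE DEEP REGION IS EMPTY FOR `l ≥ 15/8`: on admissible data, not-off-wall forces linear depth `≤ C₀^{1/4}`.
Two cases of not-off-wall beyond `P > 2R·P₀`. (A) `P > 2R·P₁`: with `P > 2R C₀^{1/4} P₀` and `prod_cube_le`,
`8R³C₀^{1/2}·P₀²P₁ < P³ ≤ (2C₀)³ P₀²P₁`, i.e. `C₀^{3(l-1+3ε)+1/2} < C₀³` — impossible once `3l - 5/2 ≥ 3`.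
(B) `P³ > 64 R³·Θ³(2C₀)³`: with `prod_sq_le_three` (`Θ³(2C₀)³ ≥ P²/P₀`) this gives `P·P₀ > 64R³`, and with
`P₀ < P/(2RC₀^{1/4})` and `P ≤ (2C₀)^{l+3ε}`: `128 R⁴ C₀^{1/4} < 2^{2l+6ε} C₀^{2l+6ε} < 128 C₀^{2l+6ε}` — impossible
once `4(l-1) + 1/4 ≥ 2l`, i.e. `l ≥ 15/8`. -/
theorem not_deep {l ε : ℝ} (hε : 0 ≤ ε) (hε2 : ε < 1 / 2) (hl : 15 / 8 ≤ l) (hl2 : l < 2)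
    {C₀ c₁ c₂ c₃ : ℕ} {M : ℕ} {X Y Z : Fin M → ℕ} (hA : Admissible l ε C₀ c₁ c₂ c₃ X Y Z)
    (i₀ i₁ : Fin M) (h0 : (i₀ : ℕ) = 0) (h1 : (i₁ : ℕ) = 1)
    (hoff : ¬ ((∏ i, ((X i : ℝ) * Y i * Z i)) ≤ 2 * (C₀ : ℝ) ^ (l - 1 + 3 * ε) * ((X i₀ : ℝ) * Y i₀ * Z i₀) ∨
      ((∏ i, ((X i : ℝ) * Y i * Z i)) ≤ 2 * (C₀ : ℝ) ^ (l - 1 + 3 * ε) * ((X i₁ : ℝ) * Y i₁ * Z i₁) ∧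
        (∏ i, ((X i : ℝ) * Y i * Z i)) ^ 3 ≤ 64 * ((C₀ : ℝ) ^ (l - 1 + 3 * ε)) ^ 3 *
          (((c₁ * shapeVal X : ℕ) : ℝ) * ((c₂ * shapeVal Y : ℕ) : ℝ) * ((c₃ * shapeVal Z : ℕ) : ℝ))))) :
    (∏ i, ((X i : ℝ) * Y i * Z i)) ≤
      2 * (C₀ : ℝ) ^ (l - 1 + 3 * ε) * (C₀ : ℝ) ^ (1 / 4 : ℝ) * ((X i₀ : ℝ) * Y i₀ * Z i₀) := by
  by_contra hnw
  push Not at hnw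
  -- notation and positivity
  set P : ℝ := ∏ i, ((X i : ℝ) * Y i * Z i) with hP
  set P₀ : ℝ := (X i₀ : ℝ) * Y i₀ * Z i₀ with hP₀
  set P₁ : ℝ := (X i₁ : ℝ) * Y i₁ * Z i₁ with hP₁
  set A : ℝ := ((c₁ * shapeVal X : ℕ) : ℝ) * ((c₂ * shapeVal Y : ℕ) : ℝ) * ((c₃ * shapeVal Z : ℕ) : ℝ)
    with hAdef
  set R : ℝ := (C₀ : ℝ) ^ (l - 1 + 3 * ε) with hRdef
  set C4 : ℝ := (C₀ : ℝ) ^ (1 / 4 : ℝ) with hC4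
  have hC₀ : (1 : ℝ) ≤ C₀ := by exact_mod_cast hA.one_le
  have hC₀pos : (0 : ℝ) < C₀ := by linarith
  have hRpos : 0 < R := Real.rpow_pos_of_pos hC₀pos _
  have hC4pos : 0 < C4 := Real.rpow_pos_of_pos hC₀pos _
  have hXpos : ∀ i, (0 : ℝ) < X i := fun i => by exact_mod_cast hA.X_pos i
  have hYpos : ∀ i, (0 : ℝ) < Y i := fun i => by exact_mod_cast hA.Y_pos i
  have hZpos : ∀ i, (0 : ℝ) < Z i := fun i => by exact_mod_cast hA.Z_pos i
  have hPpos : 0 < P := prod_pos fun i _ => mul_pos (mul_pos (hXpos i) (hYpos i)) (hZpos i)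
  have hP₀pos : 0 < P₀ := mul_pos (mul_pos (hXpos _) (hYpos _)) (hZpos _)
  have hP₁pos : 0 < P₁ := mul_pos (mul_pos (hXpos _) (hYpos _)) (hZpos _)
  -- `A ≤ (2C₀)³` (admissibility: each term `≤ 2C₀`)
  have hAle : A ≤ (2 * (C₀ : ℝ)) ^ 3 := by
    have h₁ : ((c₁ * shapeVal X : ℕ) : ℝ) ≤ 2 * (C₀ : ℝ) := by exact_mod_cast hA.valX_le
    have h₂ : ((c₂ * shapeVal Y : ℕ) : ℝ) ≤ 2 * (C₀ : ℝ) := by exact_mod_cast hA.valY_le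
    have h₃ : ((c₃ * shapeVal Z : ℕ) : ℝ) ≤ 2 * (C₀ : ℝ) := by exact_mod_cast hA.valZ_le
    rw [hAdef]
    calc ((c₁ * shapeVal X : ℕ) : ℝ) * ((c₂ * shapeVal Y : ℕ) : ℝ) * ((c₃ * shapeVal Z : ℕ) : ℝ)
        ≤ (2 * (C₀ : ℝ)) * (2 * (C₀ : ℝ)) * (2 * (C₀ : ℝ)) := by
          gcongr
      _ = (2 * (C₀ : ℝ)) ^ 3 := by ring
  -- the two structure inequalities
  have hstruct : P ^ 3 ≤ A * (P₀ ^ 2 * P₁) :=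
    prod_cube_le hA.pos₁ hA.pos₂ hA.pos₃ X Y Z hA.X_pos hA.Y_pos hA.Z_pos i₀ i₁ h0 h1
  have hstruct2 : P ^ 2 ≤ A * P₀ :=
    prod_sq_le_three hA.pos₁ hA.pos₂ hA.pos₃ X Y Z hA.X_pos hA.Y_pos hA.Z_pos i₀ h0
  -- not-off-wall, second clause: `P > 2R·P₁` or `P³ > 64 R³ A`
  have hoff' : 2 * R * P₁ < P ∨ 64 * R ^ 3 * A < P ^ 3 := by
    by_contra h
    push Not at h
    exact hoff (Or.inr h)
  -- from not-near-wall: `2R·C4·P₀ < P`, squared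
  have hnw2 : (2 * R * C4 * P₀) ^ 2 < P ^ 2 :=
    pow_lt_pow_left₀ hnw (by positivity) two_ne_zero
  rcases hoff' with hcaseA | hcaseB
  · /- (A): `8 R³ C4² · P₀² P₁ < P³ ≤ A P₀² P₁ ≤ (2C₀)³ P₀² P₁` -/
    have hprod : (2 * R * C4 * P₀) ^ 2 * (2 * R * P₁) < P ^ 2 * P :=
      mul_lt_mul'' hnw2 hcaseA (by positivity) (by positivity)
    have hkey : 8 * R ^ 3 * C4 ^ 2 * (P₀ ^ 2 * P₁) < (2 * (C₀ : ℝ)) ^ 3 * (P₀ ^ 2 * P₁) := by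
      calc 8 * R ^ 3 * C4 ^ 2 * (P₀ ^ 2 * P₁) = (2 * R * C4 * P₀) ^ 2 * (2 * R * P₁) := by ring
        _ < P ^ 2 * P := hprod
        _ = P ^ 3 := by ring
        _ ≤ A * (P₀ ^ 2 * P₁) := hstruct
        _ ≤ (2 * (C₀ : ℝ)) ^ 3 * (P₀ ^ 2 * P₁) := mul_le_mul_of_nonneg_right hAle (by positivity)
    have hkey' : 8 * R ^ 3 * C4 ^ 2 < (2 * (C₀ : ℝ)) ^ 3 :=
      lt_of_mul_lt_mul_right hkey (by positivity)
    -- exponent bookkeeping: `R³ C4² = C₀^{3(l-1+3ε)+1/2} ≥ C₀³`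
    have hexp : R ^ 3 * C4 ^ 2 = (C₀ : ℝ) ^ (3 * (l - 1 + 3 * ε) + 1 / 2) := by
      rw [hRdef, hC4, ← Real.rpow_natCast ((C₀ : ℝ) ^ (l - 1 + 3 * ε)) 3,
        ← Real.rpow_natCast ((C₀ : ℝ) ^ (1 / 4 : ℝ)) 2, ← Real.rpow_mul hC₀pos.le,
        ← Real.rpow_mul hC₀pos.le, ← Real.rpow_add hC₀pos]
      norm_num
      ring_nf
    have hge : (C₀ : ℝ) ^ (3 : ℝ) ≤ (C₀ : ℝ) ^ (3 * (l - 1 + 3 * ε) + 1 / 2) :=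
      Real.rpow_le_rpow_of_exponent_le hC₀ (by nlinarith)
    have h3 : (C₀ : ℝ) ^ (3 : ℝ) = (C₀ : ℝ) ^ 3 := by exact_mod_cast Real.rpow_natCast (C₀ : ℝ) 3
    have hge' : (C₀ : ℝ) ^ 3 ≤ R ^ 3 * C4 ^ 2 := by
      rw [hexp, ← h3]
      exact hge
    have h8 : (2 * (C₀ : ℝ)) ^ 3 = 8 * ((C₀ : ℝ) ^ 3) := by ring
    have h9 : 8 * ((C₀ : ℝ) ^ 3) ≤ 8 * (R ^ 3 * C4 ^ 2) :=
      mul_le_mul_of_nonneg_left hge' (by norm_num)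
    have h10 : 8 * R ^ 3 * C4 ^ 2 = 8 * (R ^ 3 * C4 ^ 2) := by ring
    rw [h8, h10] at hkey'
    exact absurd (lt_of_lt_of_le hkey' h9) (lt_irrefl _)
  · /- (B): `64 R³ P² ≤ 64 R³ A P₀ < P³ P₀`, so `64 R³ < P P₀ < P²/(2 R C4)`, so `128 R⁴ C4 < P²`;
       but `P² ≤ (2C₀)^{2(l+3ε)} = 2^{2(l+3ε)} C₀^{2(l+3ε)} < 128 C₀^{2(l+3ε)} ≤ 128 R⁴ C4`. -/
    have hB1 : 64 * R ^ 3 * P ^ 2 < P ^ 3 * P₀ := by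
      calc 64 * R ^ 3 * P ^ 2 ≤ 64 * R ^ 3 * (A * P₀) := mul_le_mul_of_nonneg_left hstruct2 (by positivity)
        _ = 64 * R ^ 3 * A * P₀ := by ring
        _ < P ^ 3 * P₀ := mul_lt_mul_of_pos_right hcaseB hP₀pos
    have hB2 : 64 * R ^ 3 < P * P₀ := by
      have h := lt_of_mul_lt_mul_right (show 64 * R ^ 3 * P ^ 2 < P * P₀ * P ^ 2 by nlinarith [hB1])
        (by positivity)
      exact h
    have hB3 : 64 * R ^ 3 * (2 * R * C4) < P * P := by
      calc 64 * R ^ 3 * (2 * R * C4) < P * P₀ * (2 * R * C4) := mul_lt_mul_of_pos_right hB2 (by positivity)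
        _ = P * (2 * R * C4 * P₀) := by ring
        _ ≤ P * P := mul_le_mul_of_nonneg_left hnw.le hPpos.le
    -- `P² ≤ (2C₀)^{2(l+3ε)} = 2^{2(l+3ε)} · C₀^{2(l+3ε)}`
    have hΛ : (0 : ℝ) ≤ 2 * (C₀ : ℝ) := by positivity
    have hPle : P ≤ (2 * (C₀ : ℝ)) ^ (l + 3 * ε) := hA.prod_le
    have hP2 : P * P ≤ (2 : ℝ) ^ (2 * (l + 3 * ε)) * (C₀ : ℝ) ^ (2 * (l + 3 * ε)) := by
      have h1 : P * P ≤ (2 * (C₀ : ℝ)) ^ (l + 3 * ε) * (2 * (C₀ : ℝ)) ^ (l + 3 * ε) :=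
        mul_le_mul hPle hPle hPpos.le (Real.rpow_nonneg hΛ _)
      have h2 : (2 * (C₀ : ℝ)) ^ (l + 3 * ε) * (2 * (C₀ : ℝ)) ^ (l + 3 * ε) =
          (2 : ℝ) ^ (2 * (l + 3 * ε)) * (C₀ : ℝ) ^ (2 * (l + 3 * ε)) := by
        rw [← Real.rpow_add (by positivity : (0 : ℝ) < 2 * (C₀ : ℝ)), Real.mul_rpow (by norm_num) hC₀pos.le]
        ring_nf
      rw [h2] at h1
      exact h1
    have h2lt : (2 : ℝ) ^ (2 * (l + 3 * ε)) < 128 := by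
      have h7 : (2 : ℝ) ^ (2 * (l + 3 * ε)) < (2 : ℝ) ^ (7 : ℝ) :=
        Real.rpow_lt_rpow_of_exponent_lt (by norm_num) (by linarith)
      have h7' : (2 : ℝ) ^ (7 : ℝ) = 128 := by
        rw [show (7 : ℝ) = ((7 : ℕ) : ℝ) by norm_num, Real.rpow_natCast]
        norm_num
      linarith
    have hCexp : (C₀ : ℝ) ^ (2 * (l + 3 * ε)) ≤ (C₀ : ℝ) ^ (4 * (l - 1 + 3 * ε) + 1 / 4) :=
      Real.rpow_le_rpow_of_exponent_le hC₀ (by linarith)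
    have hexp4 : R ^ 3 * (R * C4) = (C₀ : ℝ) ^ (4 * (l - 1 + 3 * ε) + 1 / 4) := by
      rw [hRdef, hC4, ← Real.rpow_natCast ((C₀ : ℝ) ^ (l - 1 + 3 * ε)) 3, ← Real.rpow_mul hC₀pos.le,
        ← Real.rpow_add hC₀pos, ← Real.rpow_add hC₀pos]
      norm_num
      ring_nf
    have hCpos2 : (0 : ℝ) < (C₀ : ℝ) ^ (2 * (l + 3 * ε)) := Real.rpow_pos_of_pos hC₀pos _
    -- chain: `128 · C₀^{4(l-1+3ε)+1/4} = 64 R³ (2 R C4) < P² ≤ 2^{…} C₀^{2(l+3ε)} < 128 C₀^{2(l+3ε)} ≤ 128 C₀^{4(…)+1/4}`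
    have hchain : 128 * (C₀ : ℝ) ^ (4 * (l - 1 + 3 * ε) + 1 / 4) < 128 * (C₀ : ℝ) ^ (4 * (l - 1 + 3 * ε) + 1 / 4) := by
      calc 128 * (C₀ : ℝ) ^ (4 * (l - 1 + 3 * ε) + 1 / 4) = 64 * R ^ 3 * (2 * R * C4) := by
            rw [← hexp4]; ring
        _ < P * P := hB3
        _ ≤ (2 : ℝ) ^ (2 * (l + 3 * ε)) * (C₀ : ℝ) ^ (2 * (l + 3 * ε)) := hP2
        _ ≤ 128 * (C₀ : ℝ) ^ (2 * (l + 3 * ε)) := mul_le_mul_of_nonneg_right h2lt.le hCpos2.le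
        _ ≤ 128 * (C₀ : ℝ) ^ (4 * (l - 1 + 3 * ε) + 1 / 4) := mul_le_mul_of_nonneg_left hCexp (by norm_num)
    exact lt_irrefl _ hchain

/-- THE REACH OF THE LINE (kernel-checked): transfer + off-wall + lever ALONE give the Mazur–Kane law at every
`s ∈ [15/8, 2)` — the deep residual is not needed there because its region is empty (`not_deep`). With the
lever proved at depth `τ₁` instead of `1/4`, the same proof gives `[2 - τ₁/2, 2)`. -/
theorem lawAt_of_offWall_nearWall (hT : TransferAt) (hO : OffWallLaw) (hN : NearWallLaw) {s : ℝ}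
    (hs : 15 / 8 ≤ s) (hs2 : s < 2) : LawAt s := by
  refine hT s (by linarith) hs2 fun l hl1 hl2 => ?_
  intro ε hε hε2 η hη
  obtain ⟨K₁, hK₁⟩ := hO l (by linarith) hl2 ε hε hε2 η hη
  obtain ⟨K₂, hK₂⟩ := hN l (by linarith) hl2 ε hε hε2 η hη
  have h2 := two_le_numShapes hε hε2
  refine ⟨max K₁ K₂, fun C₀ c₁ c₂ c₃ X Y Z hA => ?_⟩
  have hC : (0 : ℝ) ≤ (C₀ : ℝ) ^ (l - 1 + 3 * ε + η) := Real.rpow_nonneg (Nat.cast_nonneg _) _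
  have hO' := hK₁ C₀ c₁ c₂ c₃ X Y Z ⟨0, by omega⟩ ⟨1, by omega⟩ rfl rfl hA
  have hN' := hK₂ C₀ c₁ c₂ c₃ X Y Z ⟨0, by omega⟩ ⟨1, by omega⟩ rfl rfl hA
  refine (Classical.em _).elim (fun h1 => (hO' h1).trans ?_) (fun h1 => ?_)
  · exact mul_le_mul_of_nonneg_right (le_max_left _ _) hC
  · have h2' := not_deep hε.le hε2 (by linarith) hl2 hA ⟨0, by omega⟩ ⟨1, by omega⟩ rfl rfl h1
    exact (hN' h1 h2').trans (mul_le_mul_of_nonneg_right (le_max_right _ _) hC)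

/-- The reach, from the registered stubs: `MazurKaneLaw` restricted to `s ∈ [15/8, 2)` needs only STUBS 1–3. -/
theorem mazurKaneLaw_high_of (hT : Registered.stub_transfer) (hO : Registered.stub_offWall)
    (hN : Registered.stub_nearWall) : ∀ s : ℝ, 15 / 8 ≤ s → s < 2 → LawAt s :=
  fun _ hs hs2 => lawAt_of_offWall_nearWall hT hO hN hs hs2

end Summit.ABC.ABC.Cruxes.MazurKaneLaw.CriticalKloostermanPowerfulModuli

end
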